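import Summits.ResolutionOfSingularities.ResolutionOfSingularities.Theorems.StallVertexCompanion3
import HarnessLib

/-!
# StallVertexCompanion4 — decomp-res node «StallVertexCompanion (lens-5 g29, rev 10 of the node «StallVertex»;
critic row 192 CLEARED +1)», tree file 4/8 of the node

Content from the decomp-res lens-5 g29 node file `HOME/decomp-res-lens-5/g29/StallVertexCompanion.lean` (pin
deaa8fea) with the critic's ten mechanical lint fixes (fixed sha256 245dae5b; HOME =
run/shared/lean/pub/decomp-res); critic CRITIC-LEDGER row 192 CLEARED +1 — provenance, the fix list, critic text and
the lens header in full in part 2 of the node, `StallVertexCompanion`.  Namespace `…Theorems.StallVertex`;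
`--supports stmt-ResolutionOfSingularities-31770`.

## This file

Continuation 4/8 of `StallVertexCompanion` (same namespace and sections of the node, cut at the tree's 400-line cap;
section variables / opens replayed): `section AlgebraTangent`, `section Walk` — carries
`low_layer_of_staysOnNewest`, `NondefAt`, `gen_ne_zero_of_minimiser`, `nondefAt_of_lost`.

[WRITER NOTE (decomp-res writer g12): file split only (tree files ≤ 400 lines) plus the ten critic-ordered lint
fixes listed in `StallVertexCompanion`; namespace, sections, section variables / opens / `set_option maxHeartbeats …
in` lines and every declaration otherwise exactly as in the lens.]

(Sources: KawanoueMatsuki2012 arXiv:1205.4556 Prop. 3 (the companion (c_{f,𝕆}·𝕄^{-a}, μ̃·a)); Moh1987; Hauser2010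
(kangaroo points); HauserPerlega2019 §2; HauserPerlega2024; CossartPiltant2008 §2; CossartJannsenSaito2020 Ch. 8;
Benito–Villamayor (monomial case); Hironaka2005.)
-/

noncomputable section

open MvPolynomial Finset
open Literature.AlgebraicGeometry.Resolution
open Literature.AlgebraicGeometry.Resolution.Hauser2010
open Literature.AlgebraicGeometry.Resolution.HauserPerlega2024
open Literature.Barriers.ResolutionOfSingularities
open Literature.AlgebraicGeometry.Resolution.PointBlowup
open Summit.ResolutionOfSingularities.ResolutionOfSingularities.Theses
open Summit.ResolutionOfSingularities.ResolutionOfSingularities.Theorems.TightDefectClasses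
open Summit.ResolutionOfSingularities.ResolutionOfSingularities.Theorems.ProximityCut
open Summit.ResolutionOfSingularities.ResolutionOfSingularities.Theorems.ExitLaw
open Summit.ResolutionOfSingularities.ResolutionOfSingularities.Theorems.DifferentialShade

namespace Summit.ResolutionOfSingularities.ResolutionOfSingularities.Theorems.StallVertex

section AlgebraTangent

variable {σ : Type*} {K : Type*} [Field K] [Fintype σ] [DecidableEq σ] [DecidableEq K]

set_option maxHeartbeats 2000000 in
/-- **A1′ — THE STAYS-ON-NEWEST EXTRACTION** (three letters `j, j', c`).  Let `in_{d'}(G') = u_j^E (A + u_j B)` with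
`A ≠ 0` a `u_j`-free form of degree `n`, and let the NEXT move `(j', b')` — a chart change `j' ≠ j` NOT translating the
previous chart letter, `b'_j = 0` — ATTAIN the universal bound with content `(s', k')`.  Then
`A = λ · u_{j'}^{k'} u_c^{s'_c} · (u_c − b'_c u_{j'})^{n − k' − s'_c}`: the low layer is the young part times a PURE
POWER of ONE linear form through the next direction.  (In the chart `u_{j'}` the form `A` becomes a ONE-LETTER
polynomial in `u_c`; full multiplicity at `b'_c` makes it `λ (u_c − b'_c)^{D}` by the equality case
`translate_eq_homogeneousComponent_of_le_ordZero`; rehomogenise by injectivity of the chart transform.) [new] [folklore] -/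
theorem low_layer_of_staysOnNewest {d' E n : ℕ} {j j' c : σ} (hjj' : j' ≠ j) (hcj : c ≠ j) (hcj' : c ≠ j')
    (hσ : ∀ i, i = j ∨ i = j' ∨ i = c)
    (b' : σ → K) (_hb'j' : b' j' = 0) (hb'j : b' j = 0) {G' A B : MvPolynomial σ K} (_hd' : ordZero G' = d')
    (hEn : d' = E + n)
    (hΘ' : homogeneousComponent d' G' = X j ^ E * (A + X j * B)) (hA0 : A ≠ 0)
    (hA : ∀ e ∈ A.support, e.degree = n ∧ e j = 0)
    (s' : σ →₀ ℕ) (hs'j' : s' j' = 0) (hs'b : ∀ i, s' i ≠ 0 → b' i ≠ 0) (k' : ℕ)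
    (hG' : ∀ e ∈ G'.support, s' ≤ e ∧ k' ≤ e j') {n' : ℕ} (hn' : ordZero (dirForm d' j' b' G') = n')
    (hatt : n' + (s'.degree + k') = d') :
    ∃ lam : K, lam ≠ 0 ∧ k' + s' c ≤ n ∧
      A = monomial (Finsupp.single j' k' + Finsupp.single c (s' c)) lam *
        (∑ i, C ((if i = c then (1 : K) else if i = j' then -(b' c) else 0)) * X i) ^ (n - k' - s' c) := by
  classical
  have hs'j : s' j = 0 := by by_contra h; exact hs'b j h hb'j
  have hs'eq : s' = Finsupp.single c (s' c) := eq_single_of_three hσ hcj hcj' hs'j hs'j'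
  have hs'deg : s'.degree = s' c := by rw [hs'eq, Finsupp.degree_single, Finsupp.single_eq_same]
  -- the monomials of `A`
  have hAmon : ∀ e ∈ A.support, s' c ≤ e c ∧ k' ≤ e j' := by
    intro e he
    have hmem : e + Finsupp.single j E ∈ G'.support := by
      apply mem_support_of_mem_support_homogeneousComponent (d := d')
      rw [MvPolynomial.mem_support_iff, hΘ', coeff_two_layer_low j E A B (hA e he).2]
      exact MvPolynomial.mem_support_iff.mp he
    obtain ⟨hse, hke⟩ := hG' _ hmem
    refine ⟨?_, ?_⟩
    · have := hse c; rwa [hs'eq, Finsupp.single_eq_same, Finsupp.add_apply, Finsupp.single_eq_of_ne hcj,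
        add_zero] at this
    · rwa [Finsupp.add_apply, Finsupp.single_eq_of_ne hjj', add_zero] at hke
  have hkn : k' + s' c ≤ n := by
    obtain ⟨e, he⟩ := MvPolynomial.ne_zero_iff.mp hA0
    have he' := MvPolynomial.mem_support_iff.mpr he
    obtain ⟨hc, hk⟩ := hAmon e he'
    have h1 := degree_eq_add_sum_erase j' e
    have h2 : e c ≤ ∑ i ∈ univ.erase j', e i :=
      Finset.single_le_sum (f := fun i => e i) (fun i _ => Nat.zero_le _) (Finset.mem_erase.mpr ⟨hcj', Finset.mem_univ c⟩)
    have h3 := (hA e he').1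
    omega
  set D₀ := n - k' - s' c with hD₀
  -- `φA = A(u_{j'} ↦ 1)`, its support
  set φA := chartTransform n j' A with hφAdef
  have hφA0 : φA ≠ 0 := chartTransform_ne_zero n j' hA0 (fun e he => ((hA e he).1).ge)
  have hφAsupp : ∀ g ∈ φA.support, Finsupp.single c (s' c) ≤ g ∧ g.degree + k' ≤ n ∧ g j = 0 ∧ g j' = 0 := by
    intro g hg
    obtain ⟨e, he, rfl⟩ := exists_of_mem_support_chartTransform hg
    have hdeg := (hA e he).1
    refine ⟨fun i => ?_, ?_, ?_, ?_⟩
    · rw [chartExponent_apply, Finsupp.single_apply]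
      by_cases hij : i = j'
      · rw [if_pos hij, if_neg (fun h => hcj' (h.trans hij))]; exact Nat.zero_le _
      · rw [if_neg hij]
        by_cases hic : c = i
        · rw [if_pos hic, ← hic]; exact (hAmon e he).1
        · rw [if_neg hic]; exact Nat.zero_le _
    · rw [degree_chartExponent, hdeg, Nat.sub_self, zero_add]
      have := (hAmon e he).2
      omega
    · rw [chartExponent_apply, if_neg hjj'.symm]; exact (hA e he).2
    · rw [chartExponent_apply, if_pos rfl, hdeg, Nat.sub_self]
  -- `φA = u_c^{s'_c} · Q`
  have hmod : MvPolynomial.modMonomial φA (Finsupp.single c (s' c)) = 0 := by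
    ext g
    rw [coeff_zero]
    by_cases h : Finsupp.single c (s' c) ≤ g
    · exact coeff_modMonomial_of_le _ h
    · rw [coeff_modMonomial_of_not_le _ h]
      by_contra hne
      exact h (hφAsupp g (MvPolynomial.mem_support_iff.mpr hne)).1
  set Q := MvPolynomial.divMonomial φA (Finsupp.single c (s' c)) with hQdef
  have hfac : φA = monomial (Finsupp.single c (s' c)) 1 * Q := by
    have h := divMonomial_add_modMonomial φA (Finsupp.single c (s' c))
    rw [hmod, add_zero] at h
    exact h.symm
  have hQ0 : Q ≠ 0 := by intro h0; apply hφA0; rw [hfac, h0, mul_zero]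
  have hQsupp : ∀ g ∈ Q.support, g.degree ≤ D₀ ∧ g j = 0 ∧ g j' = 0 := by
    intro g hg
    have hg' : Finsupp.single c (s' c) + g ∈ φA.support := by
      rw [MvPolynomial.mem_support_iff] at hg ⊢
      rwa [hQdef, coeff_divMonomial] at hg
    obtain ⟨-, hdeg, hj0, hj'0⟩ := hφAsupp _ hg'
    rw [Finsupp.add_apply, Finsupp.single_eq_of_ne hcj.symm] at hj0
    rw [Finsupp.add_apply, Finsupp.single_eq_of_ne hcj'.symm] at hj'0
    rw [map_add, Finsupp.degree_single] at hdeg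
    refine ⟨by omega, by simpa using hj0, by simpa using hj'0⟩
  -- the direction form of the next move, two-layered
  have hdegΘ : ∀ e ∈ (homogeneousComponent d' G').support, e.degree = d' :=
    fun e he => degree_eq_of_mem_support_homogeneousComponent he
  set φB := aeval (fun i => if i = j' then (1 : MvPolynomial σ K) else X i) B with hφBdef
  have hcT : chartTransform d' j' (homogeneousComponent d' G') = X j ^ E * (φA + X j * φB) := by
    rw [chartTransform_form_eq_aeval j' hdegΘ, hΘ', map_mul, map_pow, map_add, map_mul, aeval_X, if_neg hjj'.symm,
      hφAdef, chartTransform_form_eq_aeval j' (fun e he => (hA e he).1)]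
  have hφAfree : ∀ g ∈ φA.support, g j = 0 := fun g hg => (hφAsupp g hg).2.2.1
  have hdir : dirForm d' j' b' G' =
      X j ^ E * (PointBlowup.translate b' φA + X j * PointBlowup.translate b' φB) := by
    show PointBlowup.translate b' (chartTransform d' j' (homogeneousComponent d' G')) = _
    rw [hcT, translate_X_pow_mul' b' hb'j]
    unfold PointBlowup.translate
    rw [map_add, map_mul, aeval_X, hb'j, C_0, add_zero]
  -- order bookkeeping: `D₀ ≤ ord₀ (translate b' Q)`
  have hunit : ordZero (PointBlowup.translate b' (monomial (Finsupp.single c (s' c)) (1 : K))) = 0 := by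
    refine (ordZero_eq_zero_iff _).mpr ?_
    rw [constantCoeff_translate, eval_monomial, one_mul, Finsupp.prod]
    refine Finset.prod_ne_zero_iff.mpr fun i hi => pow_ne_zero _ ?_
    have hi' := Finsupp.mem_support_iff.mp hi
    rw [Finsupp.single_apply] at hi'
    by_cases hic : c = i
    · rw [← hic]; rw [if_pos hic] at hi'; exact hs'b c hi'
    · rw [if_neg hic] at hi'; exact absurd rfl hi'
  have hordA : ordZero (PointBlowup.translate b' φA) = ordZero (PointBlowup.translate b' Q) := by
    rw [hfac, show PointBlowup.translate b' (monomial (Finsupp.single c (s' c)) 1 * Q) =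
        PointBlowup.translate b' (monomial (Finsupp.single c (s' c)) 1) * PointBlowup.translate b' Q from by
          unfold PointBlowup.translate; exact map_mul _ _ _,
      ordZero_mul, hunit, zero_add]
  have hn'eq : n' = E + D₀ := by rw [hs'deg] at hatt; omega
  have hordQ : (D₀ : ℕ∞) ≤ ordZero (PointBlowup.translate b' Q) := by
    have h1 : (n' : ℕ∞) ≤ (E : ℕ∞) + ordZero (PointBlowup.translate b' φA) := by
      rw [← hn', hdir, ordZero_mul, ordZero_X_pow]
      exact add_le_add le_rfl (ordZero_add_X_mul_le
        (fun g hg => apply_eq_zero_of_mem_support_translate b' hb'j hφAfree hg) _)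
    rw [hordA, hn'eq, Nat.cast_add] at h1
    exact (ENat.add_le_add_iff_left (ENat.coe_ne_top E)).mp h1
  -- equality case: `translate b' Q = in_{D₀} Q`, a one-letter form
  have hτQ : PointBlowup.translate b' Q = homogeneousComponent D₀ Q :=
    translate_eq_homogeneousComponent_of_le_ordZero b' (fun g hg => (hQsupp g hg).1) hordQ
  set lam := coeff (Finsupp.single c D₀) Q with hlam
  have hQ' : homogeneousComponent D₀ Q = monomial (Finsupp.single c D₀) lam := by
    ext g
    rw [coeff_homogeneousComponent, coeff_monomial]
    by_cases hgs : Finsupp.single c D₀ = g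
    · subst hgs; rw [if_pos (Finsupp.degree_single _ _), if_pos rfl]
    · rw [if_neg hgs]
      split_ifs with hdeg
      · by_contra hne
        have hg := MvPolynomial.mem_support_iff.mpr hne
        obtain ⟨-, hj0, hj'0⟩ := hQsupp g hg
        have h := eq_single_of_three hσ hcj hcj' hj0 hj'0
        have hgc : g c = D₀ := by rw [h, Finsupp.degree_single] at hdeg; exact hdeg
        exact hgs (by rw [h, hgc])
      · rfl
  have hlam0 : lam ≠ 0 := by
    intro h0
    apply translate_ne_zero b' hQ0
    rw [hτQ, hQ', h0, monomial_zero]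
  -- invert the translation: `Q = λ (u_c - b'_c)^{D₀}`
  have hQ : Q = C lam * (X c - C (b' c)) ^ D₀ := by
    rw [← translate_neg_translate b' Q, hτQ, hQ', WeightedBlowup.translate_monomial]
    congr 1
    rw [Finset.prod_eq_single c (fun i _ hic => by rw [Finsupp.single_eq_of_ne hic, pow_zero])
      (fun h => absurd (Finset.mem_univ c) h), Finsupp.single_eq_same, map_neg, sub_eq_add_neg]
  -- the candidate form and its chart transform
  set L : MvPolynomial σ K := ∑ i, C ((if i = c then (1 : K) else if i = j' then -(b' c) else 0)) * X i with hL
  have hLhom : L.IsHomogeneous 1 := isHomogeneous_linear _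
  set Ah := monomial (Finsupp.single j' k' + Finsupp.single c (s' c)) lam * L ^ D₀ with hAh
  have hAh_hom : Ah.IsHomogeneous n := by
    have hmon : (monomial (Finsupp.single j' k' + Finsupp.single c (s' c)) lam : MvPolynomial σ K).IsHomogeneous
        (Finsupp.single j' k' + Finsupp.single c (s' c)).degree := isHomogeneous_monomial _ rfl
    have h := hmon.mul (show (L ^ D₀).IsHomogeneous D₀ by simpa using hLhom.pow D₀)
    rw [map_add, Finsupp.degree_single, Finsupp.degree_single] at h
    rwa [show k' + s' c + D₀ = n by omega] at h
  have hAh_deg : ∀ e ∈ Ah.support, e.degree = n := by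
    intro e he
    by_contra hne
    exact (MvPolynomial.mem_support_iff.mp he) (hAh_hom.coeff_eq_zero hne)
  have hφL : aeval (fun i => if i = j' then (1 : MvPolynomial σ K) else X i) L = X c - C (b' c) := by
    rw [hL, map_sum]
    simp only [map_mul, algHom_C, algebraMap_eq]
    rw [Finset.sum_eq_add c j' hcj' (fun i _ hi => by rw [if_neg hi.1, if_neg hi.2, C_0, zero_mul])
      (fun h => absurd (Finset.mem_univ c) h) (fun h => absurd (Finset.mem_univ j') h),
      if_pos rfl, aeval_X, if_neg hcj', C_1, one_mul, if_neg hcj'.symm, if_pos rfl, aeval_X, if_pos rfl, mul_one,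
      map_neg, ← sub_eq_add_neg]
  have hcand : chartTransform n j' Ah = X c ^ (s' c) * (C lam * (X c - C (b' c)) ^ D₀) := by
    rw [chartTransform_form_eq_aeval j' hAh_deg, hAh, map_mul, map_pow, hφL, aeval_monomial, algebraMap_eq,
      Finsupp.prod_fintype _ _ (fun i => pow_zero _),
      Finset.prod_eq_single c (fun i _ hic => by
        by_cases hij : i = j'
        · rw [if_pos hij, one_pow]
        · rw [if_neg hij, Finsupp.add_apply, Finsupp.single_eq_of_ne (Ne.symm ?_), Finsupp.single_eq_of_ne hic,
            add_zero, pow_zero]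
          exact fun h => hij h.symm)
        (fun h => absurd (Finset.mem_univ c) h),
      if_neg hcj', Finsupp.add_apply, Finsupp.single_eq_of_ne hcj', Finsupp.single_eq_same, zero_add]
    ring
  have hφAval : φA = X c ^ (s' c) * (C lam * (X c - C (b' c)) ^ D₀) := by
    rw [hfac, hQ, X_pow_eq_monomial]
  -- injectivity of the chart transform on degree-`n` forms
  refine ⟨lam, hlam0, hkn, ?_⟩
  show A = Ah
  by_contra hne
  have hdiff : A - Ah ≠ 0 := sub_ne_zero.mpr hne
  have hdeg' : ∀ e ∈ (A - Ah).support, n ≤ e.degree := by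
    intro e he
    rcases Finset.mem_union.mp (MvPolynomial.support_sub σ _ _ he) with h | h
    · exact ((hA e h).1).ge
    · exact (hAh_deg e h).ge
  apply chartTransform_ne_zero n j' hdiff hdeg'
  have hsplit := chartTransform_add n j' (A - Ah) Ah
  rw [sub_add_cancel, ← hφAdef, hφAval, hcand] at hsplit
  exact (add_eq_right.mp hsplit.symm)

end AlgebraTangent

section Walk

variable {K : Type} [Field K] [DecidableEq K]

/-! ### §2e (rev 10, generation 29) THE FLAT LAW: on a skew stalled tail every young letter is non-deficient -/

/-- NON-DEFICIENCY of the letter `i` for the carried derivative `g_{J₀}` at time `t`: the divisor mass `μ_{P,D_i}` is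
ATTAINED by `g_{J₀}`, `μ_{P,D_i} = ord_{u_i}(g_{J₀}) / a₀` — `u_i^{ord_{u_i} g_{J₀}}` is the `i`-part of
Kawanoue–Matsuki's boundary monomial `𝕄^{a₀}` of the unit. [new object] -/
def NondefAt {q : ℕ} {s₀ : State (Fin 3) K} (W : ForcedWalk q s₀) (t : ℕ) (J₀ : Fin 3 →₀ ℕ) (i : Fin 3) : Prop :=
  (ifp W t).muPD q i = levelRatio (divisorOrder i ((ifp W t).gen J₀)) (q - J₀.degree)

/-- A minimiser's generator is non-zero on a root walk (`μ_P < ∞`). [folklore] -/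
theorem gen_ne_zero_of_minimiser {p e : ℕ} (hp : p.Prime) [CharP K p] {s₀ : State (Fin 3) K}
    (hs : IsRoot (p ^ e) s₀) (W : ForcedWalk (p ^ e) s₀) (t : ℕ) {J₀ : Fin 3 →₀ ℕ}
    (hμ : (ifp W t).muP (p ^ e) = levelRatio (ordZero ((ifp W t).gen J₀)) (p ^ e - J₀.degree)) :
    (ifp W t).gen J₀ ≠ 0 := by
  intro h0
  apply muP_ne_top hp hs W t
  rw [hμ, h0, ordZero_zero, levelRatio_top]

/-- **(D1′) LOST ⟹ NON-DEFICIENT along the walk** (`stall_ledger` (7)). [new] [folklore] -/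
theorem nondefAt_of_lost {p e : ℕ} (hp : p.Prime) [CharP K p] {s₀ : State (Fin 3) K} (hs : IsRoot (p ^ e) s₀)
    (W : ForcedWalk (p ^ e) s₀) (t : ℕ)
    (hst : (ifp W (t + 1)).muTilde (p ^ e) = (ifp W t).muTilde (p ^ e))
    {J₀ : Fin 3 →₀ ℕ} (hJ₀ : J₀ ∈ (ifp W t).idx)
    (hμ : (ifp W t).muP (p ^ e) = levelRatio (ordZero ((ifp W t).gen J₀)) (p ^ e - J₀.degree))
    {i : Fin 3} (hi : i ∈ (ifp W t).young) (hl : i = W.j t ∨ W.b t i ≠ 0) : NondefAt W t J₀ i := by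
  obtain ⟨d₀, hd₀⟩ := exists_ordZero_eq_natCast (gen_ne_zero_of_minimiser hp hs W t hμ)
  exact (stall_ledger (p ^ e) (W.j t) (W.b t) (W.onExc t) (ifp W t) (fun J hJ => (level_bounds W t J hJ).2)
    (sing_ifp hp hs W t) (by rw [← ifp_succ]; exact hst.symm.le) hJ₀ hμ hd₀).2.1 i hi hl

end Walk

end Summit.ResolutionOfSingularities.ResolutionOfSingularities.Theorems.StallVertex
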